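import Mathlib
import HarnessLib
import Summits.AtomisticToContinuum.FouriersLaw.Theses.TransferKernelPositivity

/-!
# Birth skeleton (BC3) for crux `TransferKernelPositivity.MonotoneProfile`
(item `stmt-AtomisticToContinuum-12008`, route `route-AtomisticToContinuum-TransferKernelPositivity`, crux rank 2;
sub-problem `FouriersLaw`; registrar `planner-skel-stmt-AtomisticToContinuum-12008-0`, 2026-08-17)

Crux (FIXED, concluded BY NAME below): for `pinnedChain ω₂ lam β γ` (all `> 0`), under weak-NESS uniqueness,
along any steady-state family `μ`, for every `T > 0` there is a boundary-layer width `ℓ` (NOT depending on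
`N`) such that for every `N` and every kinetic-temperature response profile `θ : Fin N → ℝ` (all profile
difference quotients `(μ_{N,T+δ/2,T−δ/2}(p_i²) − μ_{N,T,T}(p_i²))/δ` converging along `𝓝[≠] 0`),
`θ j ≤ θ i` whenever `ℓ ≤ i ≤ j ≤ N − 1 − ℓ` — the linear-response kinetic temperature is non-increasing
from the hot to the cold side on the bulk window.

## Line `birth` — KARLIN SIGN-REGULARITY (SR₂, unsigned) × ORIENTATION (mirror dominance)

Karlin's variation-diminishing theory delivers monotonicity only UP TO A GLOBAL SIGN `ε₂` (sign-regularity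
of order 2, SR₂); the sign itself is a separate, positivity-type (TP₁ / "which bath dominates") input.
The crux is cut exactly along that classical seam:

* `stub_signCoherence` (SR₂ / UNSIGNED MONOTONICITY OF THE BULK PROFILE): there is `ℓ` (not depending on
  `N`) such that any two bulk increments of `θ` have a non-negative product,
  `0 ≤ (θ(i+1) − θ(i)) · (θ(j+1) − θ(j))` for all bonds `(i,i+1)`, `(j,j+1)` inside `[ℓ, N−1−ℓ]` —
  the response profile is monotone on the bulk window in SOME direction (no bulk bump, no N-stable
  decrement reversal).  Kernel reading: the column `i ↦ K_N(N−1,i) − K_N(0,i)` of the contact transfer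
  kernel is sign-regular of order 2 on the bulk (variation diminishing; Karlin1964, KarlinMcgregor1959,
  GantmacherKrein2002 oscillation matrices: harmonic vectors of a Jacobi matrix have sign-coherent increments).
  Size L (open for `lam, β > 0`; holds in all exact harmonic-corner / BLL-proxy numerics on file, 0 reversals).
* `stub_mirrorDominance` (ORIENTATION / TP₁-type comparison): there is `ℓ` (not depending on `N`) such that
  every bulk site on the hot half responds at least as much as its mirror image on the cold half:
  `θ(N−1−i) ≤ θ(i)` for `ℓ ≤ i ≤ (N−1)/2`.  By the reflection antisymmetry `θ(N−1−i) = −θ(i)` of the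
  symmetric BLR protocol this says `θ(i) ≥ 0` on the hot half of the bulk — heating the hot bath (and cooling
  the cold one) does not cool the hot half; kernel reading `K_N(0,i) ≥ K_N(N−1,i)` left of centre (a site is
  at least as correlated with the nearer bath: TP₁ plus the diagonal TP₂ minors under the reflection symmetry
  `K(0,i) = K(N−1,N−1−i)`).  FALSE for the Rieder–Lebowitz–Lieb wall-spring harmonic chain (inverted
  boundary layers reaching through the flat bulk), true at this conjunct's harmonic corner (gen-0 / refuter
  exact Lyapunov solves, N ≤ 96).  Size L.
* COMPOSITION `MonotoneProfile_of h₁ h₂` — a DISCRETE MAXIMUM PRINCIPLE, kernel-checked and sorry-free: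
  take `ℓ = max ℓ₁ ℓ₂`; if some bulk increment were `> 0`, sign coherence makes every bulk increment `≥ 0`,
  so the profile climbs from `θ(ℓ)` to `θ(N−1−ℓ)` by at least that increment, contradicting mirror
  dominance at the pair `(ℓ, N−1−ℓ)`; hence every bulk increment is `≤ 0` and `θ j ≤ θ i` follows by
  induction along the window (`steps_nonpos_of_coherent_of_oriented`, `window_antitone`, on the zero-extended
  profile `extendZero θ : ℕ → ℝ`).

Why the cut is not a costume: `stub_signCoherence` alone allows bulk profiles monotone AGAINST the gradient
(the RLL-type inverted profile satisfies it and violates the crux); `stub_mirrorDominance` alone allows any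
bumpy profile that dominates its mirror image (e.g. antisymmetric, positive but oscillating on the hot half);
the crux needs both, and conversely implies both (so neither stub is a stronger bet than the crux itself).
BC3 probes `stub → MonotoneProfile`, `stub → FouriersLaw` by `first | exact? | simpa | aesop` FAIL for both
stubs (planner folder `bc/`, quoted in `Lines/birth.md`).
Disproof used: none on file (`ledger crux ls stmt-AtomisticToContinuum-12008`: no `Disproof.lean`, no
`Theorems/MonotoneProfile/Negative/` lemma, negatives index without a profile-type entry, 2026-08-17); the
refuter crux-attack (EVIDENCE.md 2026-08-15: hypotheses load-bearing — "no ℓ makes every profile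
bulk-monotone") is respected: both stubs keep the crux's full parameter / uniqueness / steady-state /
limit prefix verbatim, so neither is a statement about arbitrary functions `θ`.
-/

noncomputable section

namespace Summit.AtomisticToContinuum.FouriersLaw.Cruxes.MonotoneProfile

namespace Birth

/-! ## The two registered stubs -/

/-- **stub 1 — `stub_signCoherence` (Karlin SR₂: pairwise sign coherence of the bulk increments of the
linear-response kinetic-temperature profile; monotonicity up to a global sign).**  For `pinnedChain ω₂ lam β γ`
(all `> 0`), under weak-NESS uniqueness, along any steady-state family and every `T > 0` there is `ℓ : ℕ`
(independent of `N`) such that for every `N`, every response profile `θ : Fin N → ℝ` (all difference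
quotients converging to `θ i`) and all bonds `(i,i')`, `(j,j')` (`i' = i+1`, `j' = j+1`) inside the bulk
window (`ℓ ≤ i`, `i' + ℓ < N`, `ℓ ≤ j`, `j' + ℓ < N`): `0 ≤ (θ i' − θ i) * (θ j' − θ j)`. -/
theorem stub_signCoherence :
    ∀ ω₂ lam β γ : ℝ, 0 < ω₂ → 0 < lam → 0 < β → 0 < γ → (∀ (N : ℕ) (T_L T_R : ℝ), 0 < T_L → 0 < T_R → ∀ μ ν : MeasureTheory.Measure (Literature.MathematicalPhysics.KineticTheory.HeatConduction.PhaseSpace N), (Literature.MathematicalPhysics.KineticTheory.HeatConduction.pinnedChain ω₂ lam β γ).IsSteadyState N T_L T_R μ → (Literature.MathematicalPhysics.KineticTheory.HeatConduction.pinnedChain ω₂ lam β γ).IsSteadyState N T_L T_R ν → μ = ν) → ∀ μ : (N : ℕ) → ℝ → ℝ → MeasureTheory.Measure (Literature.MathematicalPhysics.KineticTheory.HeatConduction.PhaseSpace N), (∀ (N : ℕ) (T_L T_R : ℝ), 0 < T_L → 0 < T_R → (Literature.MathematicalPhysics.KineticTheory.HeatConduction.pinnedChain ω₂ lam β γ).IsSteadyState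 N T_L T_R (μ N T_L T_R)) → ∀ T : ℝ, 0 < T → ∃ ℓ : ℕ, ∀ (N : ℕ) (θ : Fin N → ℝ), (∀ i : Fin N, Filter.Tendsto (fun δ : ℝ => ((∫ x, (x.2 i) ^ 2 ∂(μ N (T + δ / 2) (T - δ / 2))) - ∫ x, (x.2 i) ^ 2 ∂(μ N T T)) / δ) (nhdsWithin 0 {(0 : ℝ)}ᶜ) (nhds (θ i))) → ∀ i i' j j' : Fin N, i'.val = i.val + 1 → j'.val = j.val + 1 → ℓ ≤ i.val → i'.val + ℓ < N → ℓ ≤ j.val → j'.val + ℓ < N → 0 ≤ (θ i' - θ i) * (θ j' - θ j) := by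
  sorry

/-- **stub 2 — `stub_mirrorDominance` (orientation: every bulk site on the hot half responds at least as
much as its mirror image on the cold half).**  For `pinnedChain ω₂ lam β γ` (all `> 0`), under weak-NESS
uniqueness, along any steady-state family and every `T > 0` there is `ℓ : ℕ` (independent of `N`) such that
for every `N`, every response profile `θ : Fin N → ℝ` (all difference quotients converging to `θ i`) and
every mirror pair `(i, j)` with `i + j = N − 1`, `ℓ ≤ i ≤ j`: `θ j ≤ θ i`.  (With the reflection
antisymmetry `θ (N−1−i) = −θ i` of the symmetric protocol: `0 ≤ θ i` on the hot half of the bulk.) -/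
theorem stub_mirrorDominance :
    ∀ ω₂ lam β γ : ℝ, 0 < ω₂ → 0 < lam → 0 < β → 0 < γ → (∀ (N : ℕ) (T_L T_R : ℝ), 0 < T_L → 0 < T_R → ∀ μ ν : MeasureTheory.Measure (Literature.MathematicalPhysics.KineticTheory.HeatConduction.PhaseSpace N), (Literature.MathematicalPhysics.KineticTheory.HeatConduction.pinnedChain ω₂ lam β γ).IsSteadyState N T_L T_R μ → (Literature.MathematicalPhysics.KineticTheory.HeatConduction.pinnedChain ω₂ lam β γ).IsSteadyState N T_L T_R ν → μ = ν) → ∀ μ : (N : ℕ) → ℝ → ℝ → MeasureTheory.Measure (Literature.MathematicalPhysics.KineticTheory.HeatConduction.PhaseSpace N), (∀ (N : ℕ) (T_L T_R : ℝ), 0 < T_L → 0 < T_R → (Literature.MathematicalPhysics.KineticTheory.HeatConduction.pinnedChain ω₂ lam β γ).IsSteadyState N T_L T_R (μ N T_L T_R)) → ∀ T : ℝ, 0 < T → ∃ ℓ : ℕ, ∀ (N : ℕ) (θ : Fin N → ℝ), (∀ i : Fin N, Filter.Tendsto (fun δ : ℝ => ((∫ x, (x.2 i) ^ 2 ∂(μ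 N (T + δ / 2) (T - δ / 2))) - ∫ x, (x.2 i) ^ 2 ∂(μ N T T)) / δ) (nhdsWithin 0 {(0 : ℝ)}ᶜ) (nhds (θ i))) → ∀ i j : Fin N, ℓ ≤ i.val → i.val ≤ j.val → i.val + j.val + 1 = N → θ j ≤ θ i := by
  sorry

/-! ## Discrete maximum principle (all sorry-free) -/

/-- Extension of a profile `θ : Fin N → ℝ` to `ℕ` by zero. -/
def extendZero {N : ℕ} (θ : Fin N → ℝ) (k : ℕ) : ℝ :=
  if h : k < N then θ ⟨k, h⟩ else 0

theorem extendZero_of_lt {N : ℕ} (θ : Fin N → ℝ) {k : ℕ} (h : k < N) :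
    extendZero θ k = θ ⟨k, h⟩ := by
  simp [extendZero, h]

theorem extendZero_val {N : ℕ} (θ : Fin N → ℝ) (i : Fin N) : extendZero θ i.val = θ i := by
  simp [extendZero, i.isLt]

/-- Non-decreasing steps on `[a, b)` give `g i ≤ g (i + n)` inside `[a, b]`. -/
theorem le_of_steps_le (g : ℕ → ℝ) (a b : ℕ) (h : ∀ k, a ≤ k → k < b → g k ≤ g (k + 1)) :
    ∀ n i, a ≤ i → i + n ≤ b → g i ≤ g (i + n) := by
  intro n
  induction n with
  | zero => intro i _ _; simp
  | succ n ih =>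
    intro i hi hb
    have h1 : g i ≤ g (i + n) := ih i hi (by omega)
    have h2 : g (i + n) ≤ g (i + n + 1) := h (i + n) (by omega) (by omega)
    have h3 : i + (n + 1) = i + n + 1 := by omega
    rw [h3]
    exact h1.trans h2

/-- Non-increasing steps on `[a, b)` give `g (i + n) ≤ g i` inside `[a, b]`. -/
theorem ge_of_steps_ge (g : ℕ → ℝ) (a b : ℕ) (h : ∀ k, a ≤ k → k < b → g (k + 1) ≤ g k) :
    ∀ n i, a ≤ i → i + n ≤ b → g (i + n) ≤ g i := by
  intro n
  induction n with
  | zero => intro i _ _; simp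
  | succ n ih =>
    intro i hi hb
    have h1 : g (i + n) ≤ g i := ih i hi (by omega)
    have h2 : g (i + n + 1) ≤ g (i + n) := h (i + n) (by omega) (by omega)
    have h3 : i + (n + 1) = i + n + 1 := by omega
    rw [h3]
    exact h2.trans h1

/-- **The discrete maximum principle of the line.**  If the increments of `g` on `[a, b)` are pairwise
sign-coherent (non-negative products) and `g b ≤ g a`, then every increment on `[a, b)` is `≤ 0`:
a positive increment would make all increments non-negative, hence `g a ≤ g k < g (k+1) ≤ g b`. -/
theorem steps_nonpos_of_coherent_of_oriented (g : ℕ → ℝ) (a b : ℕ)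
    (hcoh : ∀ k m, a ≤ k → k < b → a ≤ m → m < b → 0 ≤ (g (k + 1) - g k) * (g (m + 1) - g m))
    (hor : g b ≤ g a) : ∀ k, a ≤ k → k < b → g (k + 1) ≤ g k := by
  intro k hk hkb
  by_contra hpos
  push Not at hpos
  have hall : ∀ m, a ≤ m → m < b → g m ≤ g (m + 1) := by
    intro m hm hmb
    by_contra hneg
    push Not at hneg
    have h0 := hcoh k m hk hkb hm hmb
    have h1 : (g (k + 1) - g k) * (g (m + 1) - g m) < 0 :=
      mul_neg_of_pos_of_neg (sub_pos.mpr hpos) (sub_neg.mpr hneg)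
    linarith
  have h1 : g a ≤ g k := by
    have h := le_of_steps_le g a b hall (k - a) a le_rfl (by omega)
    rwa [Nat.add_sub_cancel' hk] at h
  have h2 : g (k + 1) ≤ g b := by
    have h := le_of_steps_le g a b hall (b - (k + 1)) (k + 1) (by omega) (by omega)
    rwa [Nat.add_sub_cancel' (show k + 1 ≤ b by omega)] at h
  linarith

/-- Window antitonicity from sign coherence + orientation (ℕ-indexed form of the composition). -/
theorem window_antitone (g : ℕ → ℝ) (a b : ℕ)
    (hcoh : ∀ k m, a ≤ k → k < b → a ≤ m → m < b → 0 ≤ (g (k + 1) - g k) * (g (m + 1) - g m))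
    (hor : g b ≤ g a) : ∀ i j, a ≤ i → i ≤ j → j ≤ b → g j ≤ g i := by
  intro i j hi hij hjb
  have hsteps := steps_nonpos_of_coherent_of_oriented g a b hcoh hor
  have h := ge_of_steps_ge g a b hsteps (j - i) i hi (by omega)
  rwa [Nat.add_sub_cancel' hij] at h

/-! ## The composition -/

/-- **Skeleton theorem — the crux `TransferKernelPositivity.MonotoneProfile` BY NAME from the two registered
stub statements** (sorry-free; the stubs enter only through `MonotoneProfile_skeleton` below).  Seam = the
discrete maximum principle above with `ℓ = max ℓ₁ ℓ₂`, applied to the zero-extended profile on the window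
`[ℓ, N − 1 − ℓ]`. -/
theorem MonotoneProfile_of
    (h1 : ∀ ω₂ lam β γ : ℝ, 0 < ω₂ → 0 < lam → 0 < β → 0 < γ → (∀ (N : ℕ) (T_L T_R : ℝ), 0 < T_L → 0 < T_R → ∀ μ ν : MeasureTheory.Measure (Literature.MathematicalPhysics.KineticTheory.HeatConduction.PhaseSpace N), (Literature.MathematicalPhysics.KineticTheory.HeatConduction.pinnedChain ω₂ lam β γ).IsSteadyState N T_L T_R μ → (Literature.MathematicalPhysics.KineticTheory.HeatConduction.pinnedChain ω₂ lam β γ).IsSteadyState N T_L T_R ν → μ = ν) → ∀ μ : (N : ℕ) → ℝ → ℝ → MeasureTheory.Measure (Literature.MathematicalPhysics.KineticTheory.HeatConduction.PhaseSpace N), (∀ (N : ℕ) (T_L T_R : ℝ), 0 < T_L → 0 < T_R → (Literature.MathematicalPhysics.KineticTheory.HeatConduction.pinnedChain ω₂ lam β γ).IsSteadyState N T_L T_R (μ N T_L T_R)) → ∀ T : ℝ, 0 < T → ∃ ℓ : ℕ, ∀ (N : ℕ) (θ : Fin N → ℝ), (∀ i : Fin N, Filter.Tendsto (fun δ : ℝ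 => ((∫ x, (x.2 i) ^ 2 ∂(μ N (T + δ / 2) (T - δ / 2))) - ∫ x, (x.2 i) ^ 2 ∂(μ N T T)) / δ) (nhdsWithin 0 {(0 : ℝ)}ᶜ) (nhds (θ i))) → ∀ i i' j j' : Fin N, i'.val = i.val + 1 → j'.val = j.val + 1 → ℓ ≤ i.val → i'.val + ℓ < N → ℓ ≤ j.val → j'.val + ℓ < N → 0 ≤ (θ i' - θ i) * (θ j' - θ j))
    (h2 : ∀ ω₂ lam β γ : ℝ, 0 < ω₂ → 0 < lam → 0 < β → 0 < γ → (∀ (N : ℕ) (T_L T_R : ℝ), 0 < T_L → 0 < T_R → ∀ μ ν : MeasureTheory.Measure (Literature.MathematicalPhysics.KineticTheory.HeatConduction.PhaseSpace N), (Literature.MathematicalPhysics.KineticTheory.HeatConduction.pinnedChain ω₂ lam β γ).IsSteadyState N T_L T_R μ → (Literature.MathematicalPhysics.KineticTheory.HeatConduction.pinnedChain ω₂ lam β γ).IsSteadyState N T_L T_R ν → μ = ν) → ∀ μ : (N : ℕ) → ℝ → ℝ → MeasureTheory.Measure (Literature.MathematicalPhysics.KineticTheory.HeatConduction.PhaseSpace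 N), (∀ (N : ℕ) (T_L T_R : ℝ), 0 < T_L → 0 < T_R → (Literature.MathematicalPhysics.KineticTheory.HeatConduction.pinnedChain ω₂ lam β γ).IsSteadyState N T_L T_R (μ N T_L T_R)) → ∀ T : ℝ, 0 < T → ∃ ℓ : ℕ, ∀ (N : ℕ) (θ : Fin N → ℝ), (∀ i : Fin N, Filter.Tendsto (fun δ : ℝ => ((∫ x, (x.2 i) ^ 2 ∂(μ N (T + δ / 2) (T - δ / 2))) - ∫ x, (x.2 i) ^ 2 ∂(μ N T T)) / δ) (nhdsWithin 0 {(0 : ℝ)}ᶜ) (nhds (θ i))) → ∀ i j : Fin N, ℓ ≤ i.val → i.val ≤ j.val → i.val + j.val + 1 = N → θ j ≤ θ i) :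
    _root_.Summit.AtomisticToContinuum.FouriersLaw.Theses.TransferKernelPositivity.MonotoneProfile := by
  intro ω₂ lam β γ hω hl hβ hγ hU μ hμ T hT
  obtain ⟨ℓ₁, hS⟩ := h1 ω₂ lam β γ hω hl hβ hγ hU μ hμ T hT
  obtain ⟨ℓ₂, hM⟩ := h2 ω₂ lam β γ hω hl hβ hγ hU μ hμ T hT
  obtain ⟨ℓ, hℓ₁, hℓ₂⟩ : ∃ ℓ : ℕ, ℓ₁ ≤ ℓ ∧ ℓ₂ ≤ ℓ := ⟨max ℓ₁ ℓ₂, le_max_left _ _, le_max_right _ _⟩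
  refine ⟨ℓ, fun N θ hθ i j hi hij hj => ?_⟩
  -- the window `[ℓ, N - 1 - ℓ]` is non-empty: it contains `i ≤ j`
  have hiN : i.val < N := i.isLt
  have hjN : j.val < N := j.isLt
  -- pairwise sign coherence of the increments of the zero-extended profile on `[ℓ, N - 1 - ℓ)`
  have hcoh : ∀ k m, ℓ ≤ k → k < N - 1 - ℓ → ℓ ≤ m → m < N - 1 - ℓ →
      0 ≤ (extendZero θ (k + 1) - extendZero θ k) * (extendZero θ (m + 1) - extendZero θ m) := by
    intro k m hk hkb hm hmb
    have hk0 : k < N := by omega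
    have hk1 : k + 1 < N := by omega
    have hm0 : m < N := by omega
    have hm1 : m + 1 < N := by omega
    have h := hS N θ hθ ⟨k, hk0⟩ ⟨k + 1, hk1⟩ ⟨m, hm0⟩ ⟨m + 1, hm1⟩ rfl rfl
      (show ℓ₁ ≤ k by omega) (show k + 1 + ℓ₁ < N by omega)
      (show ℓ₁ ≤ m by omega) (show m + 1 + ℓ₁ < N by omega)
    rw [extendZero_of_lt θ hk1, extendZero_of_lt θ hk0, extendZero_of_lt θ hm1, extendZero_of_lt θ hm0]
    exact h
  -- orientation at the mirror pair `(ℓ, N - 1 - ℓ)`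
  have hor : extendZero θ (N - 1 - ℓ) ≤ extendZero θ ℓ := by
    have hℓN : ℓ < N := by omega
    have hrN : N - 1 - ℓ < N := by omega
    have h := hM N θ hθ ⟨ℓ, hℓN⟩ ⟨N - 1 - ℓ, hrN⟩ (show ℓ₂ ≤ ℓ from hℓ₂)
      (show ℓ ≤ N - 1 - ℓ by omega) (show ℓ + (N - 1 - ℓ) + 1 = N by omega)
    rw [extendZero_of_lt θ hrN, extendZero_of_lt θ hℓN]
    exact h
  -- discrete maximum principle on the window, read back at the `Fin N` indices
  have h := window_antitone (extendZero θ) ℓ (N - 1 - ℓ) hcoh hor i.val j.val hi hij (by omega)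
  rwa [extendZero_val, extendZero_val] at h

/-- The crux by name from the two registered (sorried) stubs: the only place the stubs are consumed. -/
theorem MonotoneProfile_skeleton :
    _root_.Summit.AtomisticToContinuum.FouriersLaw.Theses.TransferKernelPositivity.MonotoneProfile :=
  MonotoneProfile_of stub_signCoherence stub_mirrorDominance

end Birth

end Summit.AtomisticToContinuum.FouriersLaw.Cruxes.MonotoneProfile

end
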